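import Summits.NavierStokesRegularity.NavierStokesRegularity.Theorems.HardyPointSinkHardyEnergyBoundAxisymmetric
import Summits.NavierStokesRegularity.NavierStokesRegularity.Theorems.HardyPointSinkHardyEnergyBoundNecessity
import HarnessLib

/-!
# Route HardyPointSink — crux `HardyEnergyBound` (item stmt-NavierStokesRegularity-7979):
# the AXISYMMETRIC SLICE of the crux is exactly axisymmetric regularity with swirl, modulo Seregin 2020

Support file (theorems only, `--supports stmt-NavierStokesRegularity-7979`; lead c5 of the crux
line, 2026-08-17).  Write `C2[axisym]` for the crux `C2 = Theses.HardyPointSink.HardyEnergyBound`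
with its datum restricted to AXISYMMETRIC Clay data (same conclusion: the local Hardy energy of
every Kato solution on `[0, T)` is bounded near every point, uniformly in the sink, up to `T`).

* `hardyEnergyBound_axisymmetric_of_axisymmetricSwirlRegularity` — `AxisymmetricSwirlRegularity →
  C2[axisym]`, unconditionally: the necessity argument of `hardyEnergyBound_of_navierStokesRegularity`
  (p155031) run with the axisymmetric conjecture leaf ns.S25 in place of the summit — the Kato
  solution agrees slice-wise a.e. with the global classical solution
  (`hardyEnergyBound_necessity_kato_ae_eq_clay`, via `isNavierStokesSolution_and_smooth_iff`), which
  is bounded on `[0, T] × B̄(xs, 1)`.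
* `hasGlobalKatoSolution_of_hardyEnergyBound_axisymmetric` — `Seregin2020 → C2[axisym] →` global
  Kato solutions for axisymmetric Clay data (the contradiction argument of
  `hardyEnergyBound_hasGlobalKatoSolution_axisymmetric`, which only ever applies C2 to axisymmetric
  data, restated with the restricted hypothesis).
* `hardyEnergyBound_axisymmetric_iff` — **`Seregin2020_axisymmetricSingularPoint_typeII →
  (C2[axisym] ↔ AxisymmetricSwirlRegularity)`**: modulo the printed theorem G. Seregin, Anal. Math.
  Phys. 10 (2020) Paper 46, Thm 2.1, the axisymmetric case of the crux IS the registered conjecture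
  leaf `Summit.NavierStokesRegularity.NavierStokesRegularity.AxisymmetricSwirlRegularity`.

References: G. Seregin, Anal. Math. Phys. 10 (2020), Paper 46, Thm 2.1 [Seregin2020]; T. Kato,
Math. Z. 187 (1984), Thms 1, 4 [Kato1984]; T. Tao, *Localisation and compactness properties of the
Navier–Stokes global regularity problem*, Anal. PDE 6 (2013), Thm 1.20 (unconditional uniqueness)
[Tao2013Localisation].
-/

noncomputable section

-- the summit and its single sub-problem share the name (CONVENTIONS §1), as in every Theorems file
set_option linter.dupNamespace false

open Set MeasureTheory Filter Topology Function Metric Module Literature.Analysis.FluidPDE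
open scoped ENNReal NNReal

namespace Summit.NavierStokesRegularity.NavierStokesRegularity.Theorems

open AxisymmetricKatoGlobal

/-- **`AxisymmetricSwirlRegularity → C2[axisym]` (unconditional).**  For an axisymmetric Clay
datum the conjecture leaf gives a global classical bounded-energy solution `(w, p)` with `w 0 = u₀`;
a Kato solution `u` on `[0, T)` from `u₀` agrees with `w` slice-wise a.e.
(`hardyEnergyBound_necessity_kato_ae_eq_clay`), `w` is bounded by some `B` on the compact
`[0, T] × B̄(xs, 1)`, so the local Hardy energy of `u t` on `B(xs, 1)` is at most `B²(5/2)|B₁|`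
for every sink and every `t ∈ [0, T)` (`hardyEnergyBound_necessity_hardy_le_of_norm_le`). -/
theorem hardyEnergyBound_axisymmetric_of_axisymmetricSwirlRegularity
    (hAX : Summit.NavierStokesRegularity.NavierStokesRegularity.AxisymmetricSwirlRegularity) :
    ∀ ν : ℝ, 0 < ν → ∀ u₀ : EuclideanSpace ℝ (Fin 3) → EuclideanSpace ℝ (Fin 3),
      ContDiff ℝ (⊤ : ℕ∞) u₀ → NSWave0.IsDivFree u₀ → HasRapidSpatialDecay u₀ → IsAxisymmetric u₀ →
      ∀ (T : ℝ) (u : ℝ → EuclideanSpace ℝ (Fin 3) → EuclideanSpace ℝ (Fin 3)), 0 < T →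
      IsKatoSolutionOn T ν u₀ u → ∀ xs : EuclideanSpace ℝ (Fin 3),
      ∃ r₀ : ℝ, 0 < r₀ ∧ ∃ K : NNReal, ∀ x₀ ∈ ball xs r₀, ∀ t ∈ Ico 0 T, T - r₀ ^ 2 < t →
        ∫⁻ x in ball xs r₀, ‖u t x‖ₑ ^ 2 / ‖x - x₀‖ₑ ≤ K := by
  -- adapted from `hardyEnergyBound_of_navierStokesRegularity` (HardyPointSinkHardyEnergyBoundNecessity.lean)
  intro ν hν u₀ hsm hdiv hdec hax T u hT hu xs
  -- the global classical solution from `u₀`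
  have hdiv' : VectorCalculus.IsDivFree u₀ := fun x => hdiv x
  obtain ⟨w, p, hcl, h0, hbe⟩ := hAX ν hν u₀ hsm hdiv' hdec hax
  obtain ⟨hns, hws, hps⟩ := isNavierStokesSolution_and_smooth_iff.2 ⟨hcl, h0⟩
  have hagree : ∀ t ∈ Ico 0 T, u t =ᵐ[volume] w t :=
    hardyEnergyBound_necessity_kato_ae_eq_clay hν hsm hdiv hdec hu hws hps hns hbe
  -- `w` is bounded on `[0, T] × B̄(xs, 1)`
  have hcont : ContinuousOn (uncurry w) (Icc 0 T ×ˢ closedBall xs 1) :=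
    hcl.smooth_velocity.continuousOn.mono (prod_mono Icc_subset_Ici_self (subset_univ _))
  obtain ⟨B, hB⟩ := (isCompact_Icc.prod (isCompact_closedBall xs 1)).exists_bound_of_continuousOn hcont
  set X : ℝ := B ^ 2 * (5 / 2 * (volume : Measure (EuclideanSpace ℝ (Fin 3))).real (ball 0 1) * 1 ^ 2)
    with hX
  refine ⟨1, one_pos, X.toNNReal, fun x₀ _ t ht _ => ?_⟩
  have hKX : ((X.toNNReal : ℝ≥0) : ℝ≥0∞) = ENNReal.ofReal X := rfl
  -- the local Hardy energy of `u t` is that of `w t`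
  have hHw : (∫⁻ x in ball xs 1, ‖u t x‖ₑ ^ 2 / ‖x - x₀‖ₑ)
      = ∫⁻ x in ball xs 1, ‖w t x‖ₑ ^ 2 / ‖x - x₀‖ₑ := by
    refine lintegral_congr_ae ?_
    filter_upwards [ae_restrict_of_ae (s := ball xs 1) (hagree t ht)] with x hx
    rw [hx]
  rw [hHw, hKX, hX]
  refine hardyEnergyBound_necessity_hardy_le_of_norm_le one_pos (fun x hx => ?_) x₀
  exact hB (t, x) ⟨⟨ht.1, ht.2.le⟩, ball_subset_closedBall hx⟩

/-- **`Seregin2020 → C2[axisym] →` global Kato solutions for axisymmetric Clay data.**  The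
contradiction argument of `hardyEnergyBound_hasGlobalKatoSolution_axisymmetric` with the crux
restricted to axisymmetric data (which is all it uses): singular point of the maximal Kato
solution (`Registered.stub_katoAxisymSingularPoint`), pressure and local energy classes to the top
(`Registered.stub_katoLocalEnergyNearTop`), off the axis bounded
(`Registered.stub_offAxisBounded_of_localEnergy`), on the axis the single-centre Hardy bound feeds
`hardyEnergyBound_axisTransfer`. [cite: Seregin2020, Thm 2.1] -/
theorem hasGlobalKatoSolution_of_hardyEnergyBound_axisymmetric
    (hSer : Seregin2020_axisymmetricSingularPoint_typeII)
    (hC2a : ∀ ν : ℝ, 0 < ν → ∀ u₀ : EuclideanSpace ℝ (Fin 3) → EuclideanSpace ℝ (Fin 3),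
      ContDiff ℝ (⊤ : ℕ∞) u₀ → NSWave0.IsDivFree u₀ → HasRapidSpatialDecay u₀ → IsAxisymmetric u₀ →
      ∀ (T : ℝ) (u : ℝ → EuclideanSpace ℝ (Fin 3) → EuclideanSpace ℝ (Fin 3)), 0 < T →
      IsKatoSolutionOn T ν u₀ u → ∀ xs : EuclideanSpace ℝ (Fin 3),
      ∃ r₀ : ℝ, 0 < r₀ ∧ ∃ K : NNReal, ∀ x₀ ∈ ball xs r₀, ∀ t ∈ Ico 0 T, T - r₀ ^ 2 < t →
        ∫⁻ x in ball xs r₀, ‖u t x‖ₑ ^ 2 / ‖x - x₀‖ₑ ≤ K) :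
    ∀ ν : ℝ, 0 < ν → ∀ u₀ : EuclideanSpace ℝ (Fin 3) → EuclideanSpace ℝ (Fin 3),
      ContDiff ℝ (⊤ : ℕ∞) u₀ → VectorCalculus.IsDivFree u₀ → HasRapidSpatialDecay u₀ →
      IsAxisymmetric u₀ → HasGlobalKatoSolution ν u₀ := by
  intro ν hν u₀ hsm hdiv hdec hax
  classical
  /- ### the datum: `L³`, weakly divergence free -/
  have hdivW : NSWave0.IsDivFree u₀ := fun x => hdiv x
  have hHk : ∀ n : ℕ, ∫⁻ x, ‖iteratedFDeriv ℝ n u₀ x‖ₑ ^ 2 < ⊤ :=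
    hdec.lintegral_enorm_iteratedFDeriv_sq_lt_top
  have hmeas0 : AEStronglyMeasurable u₀ volume := hsm.continuous.aestronglyMeasurable
  have hL2 : ∫⁻ x, ‖u₀ x‖ₑ ^ 2 < ⊤ := by
    refine lt_of_le_of_lt (le_of_eq (lintegral_congr fun x => ?_)) (hHk 0)
    rw [← ofReal_norm, ← ofReal_norm, norm_iteratedFDeriv_zero]
  have hu2 : MemLp u₀ 2 volume := ⟨hmeas0, eLpNorm_two_lt_top_of_lintegral_enorm_sq_lt_top hL2⟩
  obtain ⟨C₀, hC₀⟩ := hdec 0 0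
  have hbd0 : ∀ x, ‖u₀ x‖ ≤ C₀ := fun x => by
    have h := hC₀ x
    rwa [pow_zero, one_mul, norm_iteratedFDeriv_zero] at h
  have hu3 : MemLp u₀ 3 volume := by
    refine ⟨hmeas0, ?_⟩
    have h3 : eLpNorm u₀ 3 volume ^ 3 ≤ eLpNorm u₀ ⊤ volume * eLpNorm u₀ 2 volume ^ 2 :=
      eLpNorm_three_pow_le hmeas0
    have htop : eLpNorm u₀ ⊤ volume ≤ ENNReal.ofReal C₀ := eLpNorm_top_le_of_bound hbd0
    have hfin : eLpNorm u₀ ⊤ volume * eLpNorm u₀ 2 volume ^ 2 < ⊤ :=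
      ENNReal.mul_lt_top (htop.trans_lt ENNReal.ofReal_lt_top)
        (ENNReal.pow_lt_top hu2.eLpNorm_lt_top)
    by_contra hnot
    rw [not_lt, top_le_iff] at hnot
    rw [hnot, ENNReal.top_pow (by norm_num)] at h3
    exact absurd (h3.trans_lt hfin) (lt_irrefl _)
  have hwdiv : IsWeaklyDivFree u₀ :=
    VectorCalculus.IsDivFree.isWeaklyDivFree_holds hdiv (hsm.of_le (mod_cast le_top))
  /- ### by contradiction: the singular point of the maximal Kato solution -/
  by_contra hng
  obtain ⟨T, hT, xs, u, hK, hsmU, haxi, hsing⟩ :=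
    Registered.stub_katoAxisymSingularPoint ν hν u₀ hu3 hwdiv hax hng
  obtain ⟨p, hpax, hsw, hloc⟩ := Registered.stub_katoLocalEnergyNearTop ν hν T hT u₀ u hK hsmU haxi
  have hbdd : IsBoundedNearTop u T xs := by
    by_cases h0 : cylRadius xs = 0
    · obtain ⟨r₀, hr₀, K, hKb⟩ := hC2a ν hν u₀ hsm hdivW hdec hax T u hT hK xs
      refine hardyEnergyBound_axisTransfer hSer ν hν T hT u p hsmU haxi hpax hsw hloc xs h0
        ⟨r₀, hr₀, K, fun t ht ht0 => ?_⟩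
      exact hKb xs (mem_ball_self hr₀) t ⟨ht0.le, ht.2⟩ ht.1
    · exact Registered.stub_offAxisBounded_of_localEnergy ν hν T hT u p hsmU haxi hsw hloc xs h0
  obtain ⟨r, hr, M, hbd⟩ := hbdd
  exact absurd (hsing r hr) (Registered.eLpNorm_parabolicCylinder_lt_top_of_forall_le hbd).ne

/-- **The axisymmetric slice of the crux IS axisymmetric regularity with swirl, modulo Seregin 2020:
`Seregin2020_axisymmetricSingularPoint_typeII → (C2[axisym] ↔ AxisymmetricSwirlRegularity)`.**
(→) global Kato solution (`hasGlobalKatoSolution_of_hardyEnergyBound_axisymmetric`) converted to a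
global classical bounded-energy solution by the PROVED `clay_solution_of_hasGlobalKatoSolution_holds`;
(←) `hardyEnergyBound_axisymmetric_of_axisymmetricSwirlRegularity` (unconditional).
[cite: Seregin2020, Thm 2.1] -/
theorem hardyEnergyBound_axisymmetric_iff :
    Literature.Analysis.FluidPDE.Seregin2020_axisymmetricSingularPoint_typeII →
    ((∀ ν : ℝ, 0 < ν → ∀ u₀ : EuclideanSpace ℝ (Fin 3) → EuclideanSpace ℝ (Fin 3),
      ContDiff ℝ (⊤ : ℕ∞) u₀ → Literature.Analysis.FluidPDE.NSWave0.IsDivFree u₀ →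
      Literature.Analysis.FluidPDE.HasRapidSpatialDecay u₀ →
      Literature.Analysis.FluidPDE.IsAxisymmetric u₀ →
      ∀ (T : ℝ) (u : ℝ → EuclideanSpace ℝ (Fin 3) → EuclideanSpace ℝ (Fin 3)), 0 < T →
      Literature.Analysis.FluidPDE.IsKatoSolutionOn T ν u₀ u → ∀ xs : EuclideanSpace ℝ (Fin 3),
      ∃ r₀ : ℝ, 0 < r₀ ∧ ∃ K : NNReal, ∀ x₀ ∈ Metric.ball xs r₀, ∀ t ∈ Set.Ico 0 T, T - r₀ ^ 2 < t →
        ∫⁻ x in Metric.ball xs r₀, ‖u t x‖ₑ ^ 2 / ‖x - x₀‖ₑ ≤ K) ↔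
      Summit.NavierStokesRegularity.NavierStokesRegularity.AxisymmetricSwirlRegularity) := by
  intro hSer
  constructor
  · intro hC2a ν hν u₀ hsm hdiv hdec hax
    have hdivW : NSWave0.IsDivFree u₀ := fun x => hdiv x
    have hGK : HasGlobalKatoSolution ν u₀ :=
      hasGlobalKatoSolution_of_hardyEnergyBound_axisymmetric hSer hC2a ν hν u₀ hsm hdiv hdec hax
    obtain ⟨u, p, hu, hp, hns, hE⟩ :=
      clay_solution_of_hasGlobalKatoSolution_holds ν hν u₀ hsm hdivW hdec hGK
    obtain ⟨hcl, h0⟩ := isNavierStokesSolution_and_smooth_iff.1 ⟨hns, hu, hp⟩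
    exact ⟨u, p, hcl, h0, hE⟩
  · exact hardyEnergyBound_axisymmetric_of_axisymmetricSwirlRegularity

end Summit.NavierStokesRegularity.NavierStokesRegularity.Theorems

end
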